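import Summits.MatrixMultiplication.MatrixMultiplication.Theorems.AsymptoticRankCWSkewPencil

/-!
# The torus pencil through `T_cw,2` and `ε`, III: both Kronecker squares restrict to the whole pencil
(route `MatrixMultiplication/AsymptoticRankCW`; support item `BSkewDominatesCw` =
stmt-MatrixMultiplication-18009, stub `stub_skewDominatesCw` of the line `skew_anchor` of the crux
`BThesis` = stmt-MatrixMultiplication-0588)

`T_ρ (a, a+1, a+2) = 1`, `T_ρ (a, a+2, a+1) = ρ` (inline), `T_1 = |ε| ≅ T_cw,2`, `T_{-1} = ε`.

The intended mechanism of item 18009 is an asymptotic degeneration `ε^{⊠(k+j)} ⊵ T_cw,2^{⊠k}` with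
`j/k → 0`; honest EQUAL-format degenerations (`j = 0`) are impossible at every `k` (tree:
`not_tensorDegeneratesTo_leviCivita_cwTensor_two`, `…OddPow`; evidence `EqualFormatNoGo.md`). Here the
first FORMAT-CHANGING doors `(k, j) = (1, 1)` are opened, in both directions and uniformly along the
pencil, by explicit integer certificates (three `3 × 9` matrices with entries in `{0, ±1, ±ρ}` each,
found by exact search; `pencilSqAbs_restrictsTo_pencil`, `pencilSqLevi_restrictsTo_pencil`):

  `T_1 ⊠ T_1 (≅ perm₃ ≅ T_cw,2^{⊠2}) ≥ T_ρ`  and  `T_{-1} ⊠ T_{-1} (= ε ⊠ ε ≅ det₃) ≥ T_ρ`  for EVERY `ρ`.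

Consequences (`R̃` is restriction-monotone and `R̃(t ⊠ t) ≤ R̃(t)²`): for every `ρ`,
`R̃(T_ρ) ≤ R̃(T_cw,2)²` and `R̃(T_ρ) ≤ R̃(ε)²` (`asymptoticRank_pencil_le_cwTensor_sq`,
`asymptoticRank_pencil_le_leviCivita_sq`); in particular the two `(1,1)` doors
`asymptoticRank_cwTensor_le_leviCivita_sq : R̃(T_cw,2) ≤ R̃(ε)²` (the direction of 18009, ratio `2`)
and `asymptoticRank_leviCivita_le_cwTensor_sq : R̃(ε) ≤ R̃(T_cw,2)²`, and the supremum of `R̃` over the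
pencil is at most `min (R̃(T_cw,2)², R̃(ε)²) ≤ 16` (`iSup_asymptoticRank_pencil_le_cwTensor_sq`).
Item 18009 asks for ratio `1` instead of `2`.

References: A. Conner, F. Gesmundo, J. M. Landsberg, E. Ventura, comput. complexity 31 (2022) =
arXiv:1909.04785, Lemma 2.4, §3.2; P. Bürgisser, M. Clausen, M. A. Shokrollahi, *Algebraic Complexity
Theory* (1997), Prop. 15.25.
-/

set_option linter.dupNamespace false

noncomputable section

namespace Summit.MatrixMultiplication.MatrixMultiplication.Theorems

open Literature.Computability.AlgebraicComplexity
open Literature.Barriers.MatrixMultiplication (asymptoticRank_kroneckerPow_le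
  asymptoticRank_le_of_polyDegeneratesTo)

/-! ## Support formula for the Kronecker product of two pencil members -/

section Support

/-- **Support formula for `T_ρ ⊠ T_ρ'`**: a triple sum over `(Fin 3 × Fin 3)³` against
`T_ρ ⊠ T_ρ'` is the sum over its `36` cells (pairs of permutation cells), with weights
`1, ρ', ρ, ρρ'` according to the parities. [folklore] -/
theorem sum_mul_kronecker_pencil (ρ ρ' : ℂ)
    (g : Fin 3 × Fin 3 → Fin 3 × Fin 3 → Fin 3 × Fin 3 → ℂ) :
    ∑ a, ∑ b, ∑ c, g a b c * kroneckerTensor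
      (fun a b c : Fin 3 => (if b = a + 1 ∧ c = a + 2 then (1 : ℂ) else 0) +
        ρ * (if b = a + 2 ∧ c = a + 1 then (1 : ℂ) else 0))
      (fun a b c : Fin 3 => (if b = a + 1 ∧ c = a + 2 then (1 : ℂ) else 0) +
        ρ' * (if b = a + 2 ∧ c = a + 1 then (1 : ℂ) else 0)) a b c =
    (g (0, 0) (1, 1) (2, 2) + g (0, 1) (1, 2) (2, 0) + g (0, 2) (1, 0) (2, 1) +
      g (1, 0) (2, 1) (0, 2) + g (1, 1) (2, 2) (0, 0) + g (1, 2) (2, 0) (0, 1) +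
      g (2, 0) (0, 1) (1, 2) + g (2, 1) (0, 2) (1, 0) + g (2, 2) (0, 0) (1, 1)) +
    ρ' * (g (0, 0) (1, 2) (2, 1) + g (0, 1) (1, 0) (2, 2) + g (0, 2) (1, 1) (2, 0) +
      g (1, 0) (2, 2) (0, 1) + g (1, 1) (2, 0) (0, 2) + g (1, 2) (2, 1) (0, 0) +
      g (2, 0) (0, 2) (1, 1) + g (2, 1) (0, 0) (1, 2) + g (2, 2) (0, 1) (1, 0)) +
    ρ * (g (0, 0) (2, 1) (1, 2) + g (0, 1) (2, 2) (1, 0) + g (0, 2) (2, 0) (1, 1) +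
      g (1, 0) (0, 1) (2, 2) + g (1, 1) (0, 2) (2, 0) + g (1, 2) (0, 0) (2, 1) +
      g (2, 0) (1, 1) (0, 2) + g (2, 1) (1, 2) (0, 0) + g (2, 2) (1, 0) (0, 1)) +
    ρ * ρ' * (g (0, 0) (2, 2) (1, 1) + g (0, 1) (2, 0) (1, 2) + g (0, 2) (2, 1) (1, 0) +
      g (1, 0) (0, 2) (2, 1) + g (1, 1) (0, 0) (2, 2) + g (1, 2) (0, 1) (2, 0) +
      g (2, 0) (1, 2) (0, 1) + g (2, 1) (1, 0) (0, 2) + g (2, 2) (1, 1) (0, 0)) := by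
  -- inner sum over the second coordinates, by the one-factor support formula
  have inner : ∀ a₁ b₁ c₁ : Fin 3,
      ∑ a₂ : Fin 3, ∑ b₂ : Fin 3, ∑ c₂ : Fin 3, g (a₁, a₂) (b₁, b₂) (c₁, c₂) *
        ((fun a b c : Fin 3 => (if b = a + 1 ∧ c = a + 2 then (1 : ℂ) else 0) +
          ρ * (if b = a + 2 ∧ c = a + 1 then (1 : ℂ) else 0)) a₁ b₁ c₁ *
         (fun a b c : Fin 3 => (if b = a + 1 ∧ c = a + 2 then (1 : ℂ) else 0) +
          ρ' * (if b = a + 2 ∧ c = a + 1 then (1 : ℂ) else 0)) a₂ b₂ c₂) =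
      (g (a₁, 0) (b₁, 1) (c₁, 2) + g (a₁, 1) (b₁, 2) (c₁, 0) + g (a₁, 2) (b₁, 0) (c₁, 1) +
          ρ' * (g (a₁, 0) (b₁, 2) (c₁, 1) + g (a₁, 1) (b₁, 0) (c₁, 2) + g (a₁, 2) (b₁, 1) (c₁, 0))) *
        (fun a b c : Fin 3 => (if b = a + 1 ∧ c = a + 2 then (1 : ℂ) else 0) +
          ρ * (if b = a + 2 ∧ c = a + 1 then (1 : ℂ) else 0)) a₁ b₁ c₁ := by
    intro a₁ b₁ c₁
    rw [← sum_mul_pencil ρ' (fun a₂ b₂ c₂ => g (a₁, a₂) (b₁, b₂) (c₁, c₂)), Finset.sum_mul]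
    refine Finset.sum_congr rfl fun a₂ _ => ?_
    rw [Finset.sum_mul]
    refine Finset.sum_congr rfl fun b₂ _ => ?_
    rw [Finset.sum_mul]
    refine Finset.sum_congr rfl fun c₂ _ => ?_
    ring
  -- split each pair-indexed sum and regroup as (outer first coordinates) ∘ (inner second coordinates)
  have split : ∑ a, ∑ b, ∑ c, g a b c * kroneckerTensor
      (fun a b c : Fin 3 => (if b = a + 1 ∧ c = a + 2 then (1 : ℂ) else 0) +
        ρ * (if b = a + 2 ∧ c = a + 1 then (1 : ℂ) else 0))
      (fun a b c : Fin 3 => (if b = a + 1 ∧ c = a + 2 then (1 : ℂ) else 0) +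
        ρ' * (if b = a + 2 ∧ c = a + 1 then (1 : ℂ) else 0)) a b c =
      ∑ a₁ : Fin 3, ∑ b₁ : Fin 3, ∑ c₁ : Fin 3,
        ∑ a₂ : Fin 3, ∑ b₂ : Fin 3, ∑ c₂ : Fin 3, g (a₁, a₂) (b₁, b₂) (c₁, c₂) *
        ((fun a b c : Fin 3 => (if b = a + 1 ∧ c = a + 2 then (1 : ℂ) else 0) +
          ρ * (if b = a + 2 ∧ c = a + 1 then (1 : ℂ) else 0)) a₁ b₁ c₁ *
         (fun a b c : Fin 3 => (if b = a + 1 ∧ c = a + 2 then (1 : ℂ) else 0) +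
          ρ' * (if b = a + 2 ∧ c = a + 1 then (1 : ℂ) else 0)) a₂ b₂ c₂) := by
    simp only [Fintype.sum_prod_type, kroneckerTensor_apply]
    exact (sum_interleave₃ (fun a₁ b₁ c₁ a₂ b₂ c₂ => g (a₁, a₂) (b₁, b₂) (c₁, c₂) *
      ((fun a b c : Fin 3 => (if b = a + 1 ∧ c = a + 2 then (1 : ℂ) else 0) +
          ρ * (if b = a + 2 ∧ c = a + 1 then (1 : ℂ) else 0)) a₁ b₁ c₁ *
        (fun a b c : Fin 3 => (if b = a + 1 ∧ c = a + 2 then (1 : ℂ) else 0) +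
          ρ' * (if b = a + 2 ∧ c = a + 1 then (1 : ℂ) else 0)) a₂ b₂ c₂))).symm
  rw [split]
  simp only [inner]
  rw [sum_mul_pencil ρ]
  ring

end Support

/-! ## `T_1 ⊠ T_1 ≥ T_ρ` and `ε ⊠ ε ≥ T_ρ` for every `ρ` -/

section Doors

/-- **`T_1 ⊠ T_1 ≥ T_ρ` for every `ρ`** (`T_1 ⊠ T_1 ≅ perm₃ ≅ T_cw,2^{⊠2}`): an explicit restriction
with integer certificates — `A = A₀ + ρ A₁`, `B`, `C : ℂ³ ← ℂ⁹` with entries in `{0, ±1, ±ρ}`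
(`17` non-zero entries in all; found by exact search, verified here cell by cell). In particular
`perm₃ ≥ ε` honestly: the reverse `(1,1)` door. [folklore] -/
theorem pencilSqAbs_restrictsTo_pencil (ρ : ℂ) :
    TensorRestrictsTo
      (kroneckerTensor
        (fun a b c : Fin 3 => (if b = a + 1 ∧ c = a + 2 then (1 : ℂ) else 0) +
          1 * (if b = a + 2 ∧ c = a + 1 then (1 : ℂ) else 0))
        (fun a b c : Fin 3 => (if b = a + 1 ∧ c = a + 2 then (1 : ℂ) else 0) +
          1 * (if b = a + 2 ∧ c = a + 1 then (1 : ℂ) else 0)))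
      (fun a b c : Fin 3 => (if b = a + 1 ∧ c = a + 2 then (1 : ℂ) else 0) +
        ρ * (if b = a + 2 ∧ c = a + 1 then (1 : ℂ) else 0)) := by
  refine ⟨fun i a => ![![![(0 : ℂ), 0, 0], ![0, 0, ρ], ![1, 0, 0]],
      ![![ρ, 0, 0], ![0, -1, 0], ![0, 0, 0]],
      ![![0, ρ, -1], ![0, 0, 0], ![0, -ρ, -1]]] i a.1 a.2,
    fun j b => ![![![(0 : ℂ), 0, 0], ![1, 0, 0], ![0, 0, -1]],
      ![![0, 0, -1], ![0, 0, 0], ![0, 0, 0]],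
      ![![-1, 0, 0], ![0, 0, 0], ![1, 0, 0]]] j b.1 b.2,
    fun k c => ![![![(0 : ℂ), 0, -1], ![1, 0, 0], ![0, 0, 0]],
      ![![0, 0, 0], ![0, 0, 0], ![0, -1, 0]],
      ![![0, 0, 0], ![0, -1, 0], ![0, 0, 0]]] k c.1 c.2, fun i j k => ?_⟩
  rw [sum_mul_kronecker_pencil 1 1]
  fin_cases i <;> fin_cases j <;> fin_cases k <;> simp

/-- **`ε ⊠ ε ≥ T_ρ` for every `ρ`** (`ε ⊠ ε = T_{-1} ⊠ T_{-1} ≅ det₃`): an explicit restriction with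
integer certificates (`19` non-zero entries in `{0, ±1, ±ρ, ρ - 1}`). In particular `det₃ ≥ T_cw,2`
honestly: the first format-changing door `(k,j) = (1,1)` in the direction of item 18009. [folklore] -/
theorem pencilSqLevi_restrictsTo_pencil (ρ : ℂ) :
    TensorRestrictsTo
      (kroneckerTensor
        (fun a b c : Fin 3 => (if b = a + 1 ∧ c = a + 2 then (1 : ℂ) else 0) +
          (-1) * (if b = a + 2 ∧ c = a + 1 then (1 : ℂ) else 0))
        (fun a b c : Fin 3 => (if b = a + 1 ∧ c = a + 2 then (1 : ℂ) else 0) +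
          (-1) * (if b = a + 2 ∧ c = a + 1 then (1 : ℂ) else 0)))
      (fun a b c : Fin 3 => (if b = a + 1 ∧ c = a + 2 then (1 : ℂ) else 0) +
        ρ * (if b = a + 2 ∧ c = a + 1 then (1 : ℂ) else 0)) := by
  refine ⟨fun i a => ![![![(0 : ℂ), 0, ρ], ![0, 0, -1], ![0, 0, 0]],
      ![![-1, 0, 0], ![-ρ, 0, -ρ], ![0, 0, 0]],
      ![![0, -1, 0], ![0, 0, 0], ![-1 + ρ, 0, 0]]] i a.1 a.2,
    fun j b => ![![![(1 : ℂ), 0, 0], ![0, 0, 0], ![0, 0, -1]],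
      ![![0, -1, -1], ![0, 0, 0], ![1, 0, 0]],
      ![![1, 0, 0], ![0, 0, 0], ![0, -1, 0]]] j b.1 b.2,
    fun k c => ![![![(0 : ℂ), 0, 0], ![0, 0, -1], ![0, 0, 0]],
      ![![0, 0, 0], ![-1, 0, 0], ![0, 0, 0]],
      ![![0, -1, 0], ![0, 0, 0], ![0, 0, 1]]] k c.1 c.2, fun i j k => ?_⟩
  rw [sum_mul_kronecker_pencil (-1) (-1)]
  fin_cases i <;> fin_cases j <;> fin_cases k <;> simp

/-- The same with the route's inline Levi-Civita tensor: **`ε ⊠ ε ≥ T_ρ`** for every `ρ`. [folklore] -/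
theorem leviCivitaSq_restrictsTo_pencil (ρ : ℂ) :
    TensorRestrictsTo
      (kroneckerTensor
        (fun a b c : Fin 3 => (if b = a + 1 ∧ c = a + 2 then (1 : ℂ) else 0) -
          (if b = a + 2 ∧ c = a + 1 then 1 else 0))
        (fun a b c : Fin 3 => (if b = a + 1 ∧ c = a + 2 then (1 : ℂ) else 0) -
          (if b = a + 2 ∧ c = a + 1 then 1 else 0)))
      (fun a b c : Fin 3 => (if b = a + 1 ∧ c = a + 2 then (1 : ℂ) else 0) +
        ρ * (if b = a + 2 ∧ c = a + 1 then (1 : ℂ) else 0)) := by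
  rw [← pencil_neg_one_eq_leviCivita]
  exact pencilSqLevi_restrictsTo_pencil ρ

/-- In particular **`det₃ ≥ T_cw,2` honestly**: `ε ⊠ ε ≥ T_1 ≥ 2|ε| ≥ T_cw,2`. [folklore] -/
theorem leviCivitaSq_restrictsTo_cwTensor :
    TensorRestrictsTo
      (kroneckerTensor
        (fun a b c : Fin 3 => (if b = a + 1 ∧ c = a + 2 then (1 : ℂ) else 0) -
          (if b = a + 2 ∧ c = a + 1 then 1 else 0))
        (fun a b c : Fin 3 => (if b = a + 1 ∧ c = a + 2 then (1 : ℂ) else 0) -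
          (if b = a + 2 ∧ c = a + 1 then 1 else 0)))
      (cwTensor ℂ 2) := by
  refine ((leviCivitaSq_restrictsTo_pencil 1).trans ?_).trans levi_restrictsTo_cwTensor
  rw [two_mul_absLeviCivita_eq_pencil_one]
  exact tensorRestrictsTo_const_mul _ _

/-- And **`perm₃-type square ≥ ε` honestly**: `T_1 ⊠ T_1 ≥ T_{-1} = ε`. [folklore] -/
theorem pencilSqAbs_restrictsTo_leviCivita :
    TensorRestrictsTo
      (kroneckerTensor
        (fun a b c : Fin 3 => (if b = a + 1 ∧ c = a + 2 then (1 : ℂ) else 0) +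
          1 * (if b = a + 2 ∧ c = a + 1 then (1 : ℂ) else 0))
        (fun a b c : Fin 3 => (if b = a + 1 ∧ c = a + 2 then (1 : ℂ) else 0) +
          1 * (if b = a + 2 ∧ c = a + 1 then (1 : ℂ) else 0)))
      (fun a b c : Fin 3 => (if b = a + 1 ∧ c = a + 2 then (1 : ℂ) else 0) -
        (if b = a + 2 ∧ c = a + 1 then 1 else 0)) := by
  rw [← pencil_neg_one_eq_leviCivita]
  exact pencilSqAbs_restrictsTo_pencil (-1)

end Doors

/-! ## Consequences for asymptotic ranks along the pencil -/

section Consequences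

/-- `T_cw,2 ≥ T_1` (`T_cw,2 ≥ 2|ε| = 2 T_1 ≥ T_1`). [cite: ConnerGesmundoLandsbergVentura2022, §3.2 (proof of Lemma 2.4)] -/
theorem cwTensor_restrictsTo_pencil_one :
    TensorRestrictsTo (cwTensor ℂ 2)
      (fun a b c : Fin 3 => (if b = a + 1 ∧ c = a + 2 then (1 : ℂ) else 0) +
        1 * (if b = a + 2 ∧ c = a + 1 then (1 : ℂ) else 0)) := by
  refine cwTensor_restrictsTo_levi.trans ?_
  rw [two_mul_absLeviCivita_eq_pencil_one]
  exact tensorRestrictsTo_of_const_mul _ (by norm_num)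

/-- `T_1 ≥ T_cw,2` (`T_1 ≥ 2 T_1 = 2|ε| ≥ T_cw,2`). [cite: ConnerGesmundoLandsbergVentura2022, §3.2 (proof of Lemma 2.4)] -/
theorem pencil_one_restrictsTo_cwTensor :
    TensorRestrictsTo
      (fun a b c : Fin 3 => (if b = a + 1 ∧ c = a + 2 then (1 : ℂ) else 0) +
        1 * (if b = a + 2 ∧ c = a + 1 then (1 : ℂ) else 0)) (cwTensor ℂ 2) := by
  refine TensorRestrictsTo.trans ?_ levi_restrictsTo_cwTensor
  rw [two_mul_absLeviCivita_eq_pencil_one]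
  exact tensorRestrictsTo_const_mul _ _

/-- `R̃(t ⊠ t) ≤ R̃(t)²` for a `3 × 3 × 3` tensor (`t ⊠ t` is the reindexed `t^{⊗2}`, and
`R̃(t^{⊗2}) ≤ R̃(t)²`). [cite: ChristandlVranaZuiddam2023, §1.1] -/
theorem asymptoticRank_kronecker_self_le_sq (t : Fin 3 → Fin 3 → Fin 3 → ℂ) :
    asymptoticRank (kroneckerTensor t t) ≤ asymptoticRank t ^ 2 := by
  have h1 : asymptoticRank (kroneckerTensor t t) = asymptoticRank (kroneckerPow t 2) := by
    have e : squareReindex (kroneckerPow t 2) = kroneckerTensor t t := by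
      funext a b c
      rw [squareReindex_kroneckerPow_two, kroneckerTensor_apply]
    rw [← e]
    exact asymptoticRank_eq_of_restrictsTo (restrictsTo_squareReindex _).1
      (restrictsTo_squareReindex _).2
  rw [h1]
  exact asymptoticRank_kroneckerPow_le _ (by norm_num)

/-- **`R̃(T_ρ) ≤ R̃(T_cw,2)²` for every `ρ`**: `T_ρ ≤ T_1 ⊠ T_1` and `R̃(T_1 ⊠ T_1) ≤ R̃(T_1)² = R̃(T_cw,2)²`.
[folklore] -/
theorem asymptoticRank_pencil_le_cwTensor_sq (ρ : ℂ) :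
    asymptoticRank (fun a b c : Fin 3 => (if b = a + 1 ∧ c = a + 2 then (1 : ℂ) else 0) +
        ρ * (if b = a + 2 ∧ c = a + 1 then (1 : ℂ) else 0)) ≤ asymptoticRank (cwTensor ℂ 2) ^ 2 := by
  refine (asymptoticRank_le_of_polyDegeneratesTo
    (pencilSqAbs_restrictsTo_pencil ρ).polyDegeneratesTo).trans ?_
  rw [← asymptoticRank_pencil_one]
  exact asymptoticRank_kronecker_self_le_sq _

/-- **`R̃(T_ρ) ≤ R̃(ε)²` for every `ρ`**: `T_ρ ≤ ε ⊠ ε` and `R̃(ε ⊠ ε) = R̃(ε)²`. [folklore] -/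
theorem asymptoticRank_pencil_le_leviCivita_sq (ρ : ℂ) :
    asymptoticRank (fun a b c : Fin 3 => (if b = a + 1 ∧ c = a + 2 then (1 : ℂ) else 0) +
        ρ * (if b = a + 2 ∧ c = a + 1 then (1 : ℂ) else 0)) ≤
      asymptoticRank (fun a b c : Fin 3 => (if b = a + 1 ∧ c = a + 2 then (1 : ℂ) else 0) -
        (if b = a + 2 ∧ c = a + 1 then 1 else 0)) ^ 2 := by
  rw [← asymptoticRank_leviCivita_sq_eq_sq]
  exact asymptoticRank_le_of_polyDegeneratesTo (leviCivitaSq_restrictsTo_pencil ρ).polyDegeneratesTo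

/-- **The `(1,1)` door in the direction of item 18009**: `R̃(T_cw,2) ≤ R̃(ε)²` (`det₃ ≥ T_cw,2`).
Item 18009 asks for exponent `1`. [folklore] -/
theorem asymptoticRank_cwTensor_le_leviCivita_sq :
    asymptoticRank (cwTensor ℂ 2) ≤
      asymptoticRank (fun a b c : Fin 3 => (if b = a + 1 ∧ c = a + 2 then (1 : ℂ) else 0) -
        (if b = a + 2 ∧ c = a + 1 then 1 else 0)) ^ 2 := by
  rw [← asymptoticRank_pencil_one]
  exact asymptoticRank_pencil_le_leviCivita_sq 1

/-- **The reverse `(1,1)` door**: `R̃(ε) ≤ R̃(T_cw,2)²` (`perm₃ ≥ ε`). [folklore] -/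
theorem asymptoticRank_leviCivita_le_cwTensor_sq :
    asymptoticRank (fun a b c : Fin 3 => (if b = a + 1 ∧ c = a + 2 then (1 : ℂ) else 0) -
        (if b = a + 2 ∧ c = a + 1 then 1 else 0)) ≤ asymptoticRank (cwTensor ℂ 2) ^ 2 := by
  rw [← pencil_neg_one_eq_leviCivita]
  exact asymptoticRank_pencil_le_cwTensor_sq (-1)

/-- **The supremum of `R̃` over the pencil is at most `R̃(T_cw,2)² ≤ 16`** (every member, generic ones
included, is a restriction of `T_1 ⊠ T_1`; `R̃(T_cw,2) ≤ 4`). [folklore] -/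
theorem iSup_asymptoticRank_pencil_le_cwTensor_sq :
    (⨆ ρ : ℂ, asymptoticRank (fun a b c : Fin 3 => (if b = a + 1 ∧ c = a + 2 then (1 : ℂ) else 0) +
        ρ * (if b = a + 2 ∧ c = a + 1 then (1 : ℂ) else 0))) ≤ asymptoticRank (cwTensor ℂ 2) ^ 2 ∧
    asymptoticRank (cwTensor ℂ 2) ^ 2 ≤ 16 := by
  refine ⟨ciSup_le fun ρ => asymptoticRank_pencil_le_cwTensor_sq ρ, ?_⟩
  nlinarith [asymptoticRank_cwTensor_two_le_four, three_le_asymptoticRank_cwTensor_two]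

/-- Likewise `sup ≤ R̃(ε)² = R̃(ε ⊠ ε) ≤ 17` (every member is a restriction of `ε ⊠ ε ≅ det₃`,
`bR(det₃) ≤ 17`). [cite: ConnerGesmundoLandsbergVentura2022, §1.3] -/
theorem iSup_asymptoticRank_pencil_le_leviCivita_sq :
    (⨆ ρ : ℂ, asymptoticRank (fun a b c : Fin 3 => (if b = a + 1 ∧ c = a + 2 then (1 : ℂ) else 0) +
        ρ * (if b = a + 2 ∧ c = a + 1 then (1 : ℂ) else 0))) ≤
      asymptoticRank (fun a b c : Fin 3 => (if b = a + 1 ∧ c = a + 2 then (1 : ℂ) else 0) -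
        (if b = a + 2 ∧ c = a + 1 then 1 else 0)) ^ 2 ∧
    asymptoticRank (fun a b c : Fin 3 => (if b = a + 1 ∧ c = a + 2 then (1 : ℂ) else 0) -
        (if b = a + 2 ∧ c = a + 1 then 1 else 0)) ^ 2 ≤ 17 := by
  refine ⟨ciSup_le fun ρ => asymptoticRank_pencil_le_leviCivita_sq ρ, ?_⟩
  rw [← asymptoticRank_leviCivita_sq_eq_sq]
  exact asymptoticRank_leviCivita_sq_le_seventeen

end Consequences

end Summit.MatrixMultiplication.MatrixMultiplication.Theorems

end
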